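import Literature.Probability.Percolation.SlabMSFEvents
import Summits.CriticalPhenomena.PercolationContinuityZ3.Theorems.PercAnnulusCrossingSlabMSFIndependence
import Summits.CriticalPhenomena.PercolationContinuityZ3.Theorems.PercAnnulusCrossingSlabMSFMeasurability
import Summits.CriticalPhenomena.PercolationContinuityZ3.Theorems.PercAnnulusCrossingSlabMSFPlusCount
import Summits.CriticalPhenomena.PercolationContinuityZ3.Theorems.PercNearOneGluingNoHeavyRsw3InvasionTreesDichotomy
import HarnessLib

/-!
# RSW3 lane (P1, gen 34): NTW 2017 §4 — THE RENEWAL ASSEMBLY OF THEOREM 2.4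
# (the events in the vocabulary of `SlabMSFEvents`; `𝓩^i ∈ σ(U_e : e ∈ F_i)`; independence of `C ∩ D′`; "𝓩^i occurs for some i"
# from Lemma 4.1 taken as a hypothesis; NTW's Proposition 2.3 reduction `invasionMeet → thm24`)

builds on p205010 (kernel theorem, internal audit signed; external expert review pending) — NOT used in this file.

Cell `prim-rsw3`, prover seat `prim-rsw3-p1` (gen 34), build-out blueprint `prim-rsw3-lead/gen44/BUILDOUT-PLAN.md` §6 (F9
minus Lemma 4.1) of the sequel NTW 2017 Thm 2.4, in the division agreed on the lane bus (lead GEN 45, 14:08Z 2026-08-27: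
"p1 = bridge + renewal packaging / Prop 2.3 reduction with hglue as a HYPOTHESIS; lead = the closer").  Support file
(`--supports stmt-CriticalPhenomena-4575`); no definitions, no named facts, no sorries.

Newman–Tassion–Wu (arXiv:1512.09107, p. 19): «Combined with Lemma 4.1 below, this implies for all `i > i₀`, `P[𝓑_0^{m_i},
𝓑_x^{m_i}, 𝓨_A^i] ≥ c₁ P[A]` … Since `𝓩^{i-1}` is measurable with respect to the state of edges in `B̄_{m_{i-1}}`, … It then
follows by comparison to a sequence of i.i.d trials … that `P(𝓑_0^{m_i}, 𝓑_x^{m_i}, C_{n_i,2n_i} i.o.) = 1`.  In particular,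
with probability one, `𝓩_x^i` occurs for some `i > i₀`, which implies `V(Γ_min^{(i)}) ⊆ 𝓘_0 ∩ 𝓘_x`, and completes the proof
of Theorem 2.4.», and §2.4 (Prop. 2.3): «it suffices to prove that for any `x ∈ S_k`, `𝓘_0 ∩ 𝓘_x ≠ ∅`».  In the vocabulary of
`SlabMSFEvents` (`evCircuit` = `C`, `evBlocked` = `D′`, `evGlued k p n N M a` = `𝓑_a^{M+1}`, at the scales of
`…SlabMSFScales`: `n = r i`, `N = 2 r i`, `M = m i − 1`; `F i` = the pairs over `B̄_{m_i}`):

* BRIDGE: `evCircuit_inter_evBlocked_eq`, **`labelMeasure_real_evCircuit_inter_evBlocked_inter_eq_mul`** (independence of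
  `C ∩ D′` from the labels of the pairs over `B̄_{M₀}`, `M₀ ≤ n`), `glued_inter_eq_setOf`, `measurableSet_glued_inter`,
  **`exists_preimage_eq_glued_inter`** (`𝓩 = 𝓑_o ∩ 𝓑_x ∩ C` is read off the labels of any finite `F ⊇` pairs over `B̄_{M+1}`);
* RENEWAL: `nonempty_invadedRegion_inter_of_mem_glued` (on `𝓩`, `Γ_min ≠ ∅` lies in `𝓘_o ∩ 𝓘_x`),
  **`ae_nonempty_invadedRegion_inter_of_glue`** (the conditional bound `c · μ(A) ≤ μ(𝓩^i ∩ A)`, `A ∈ σ(F_{i-1})`, `i > i₀`,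
  gives `𝓘_o ∩ 𝓘_x ≠ ∅` a.s., by `NTW17.ae_frequently_mem_labelMeasure`);
* **`invasionMeet_of_lemma41`** — the statement of NTW §4 for `x`, from Lemma 4.1 in the exact shape of the lane's
  `real_glued_inter_preimage_ge` (lead GEN 45, `T/…SlabMSFGluing`) taken as a HYPOTHESIS, the scales with independence
  (`exists_scaleSequences_indep`, separation `g t = t + 2`) and the uniform exponent `s = (9 (k+1))²`;
* **`NewmanTassionWu2017.thm24_of_invasionMeet`** — Proposition 2.3 on the slab: `NewmanTassionWu2017_invasionMeet →
  NewmanTassionWu2017_thm24` (`Rsw3.wmsf_reachable_of_common_vertex` with a.s. injective labels).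

References: C. M. Newman, V. Tassion, W. Wu, *Critical percolation and the minimal spanning tree in slabs*, CPAM 70
(2017), arXiv:1512.09107, §2.4 (Prop. 2.3) and §4 (proof of Thm 2.4, p. 19) [NewmanTassionWu2017]; R. Lyons, Y. Peres,
O. Schramm, *Minimal spanning forests*, Ann. Probab. 34 (2006) Prop. 3.3 [LyonsPeresSchramm2006].
-/

noncomputable section

namespace Summit.CriticalPhenomena.PercolationContinuityZ3.Theorems.Crossing

open MeasureTheory Filter
open Literature.Probability.Percolation Literature.Probability.Percolation.NTW17
open Literature.Probability.Percolation.Invasion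

variable {k : ℕ}

/-! ## Bridge: the events of `SlabMSFEvents` and the generic locality / independence lemmas -/

section Bridge

/-- `C ∩ D′` as the pull-back of a configuration event. [cite: NewmanTassionWu2017, §4 (C_{a,b}, D_{a,b}, p. 19)] -/
theorem evCircuit_inter_evBlocked_eq (p : ℝ) (n N M : ℕ) :
    evCircuit k p n N ∩ evBlocked k p N M =
      (fun U : Sym2 (slab 3 k) → ℝ => configOfLabels p U (slabGraph 3 k)) ⁻¹'
        (circuitAround k 0 n N ∩ (slabConn k (sqBox 0 (M + 1)) (sqBox 0 (N + 1)) (sqSphere 0 (M + 1)))ᶜ) :=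
  Set.ext fun _ => Iff.rfl

/-- **Independence of `C_{n,N} ∩ D′_{N,M}` from the past**: for a finite set `F` of pairs over `B̄_{M₀}`, `M₀ ≤ n ≤ N ≤ M+1`,
and `A = {U | (U e)_{e ∈ F} ∈ s}`: `μ(C ∩ D′ ∩ A) = μ(C ∩ D′) · μ(A)`.
[cite: NewmanTassionWu2017, §4 proof of Lemma 4.1 (p. 20: 𝓨_A = C ∩ D ∩ A, A ∈ σ(η_e : e ∈ B̄_{m_{i-1}}))] -/
theorem labelMeasure_real_evCircuit_inter_evBlocked_inter_eq_mul {M₀ n N M : ℕ} (hM₀ : M₀ ≤ n) (hnN : n ≤ N)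
    (hNM : N ≤ M + 1) (p : ℝ) (F : Finset (Sym2 (slab 3 k))) (hF : ∀ e ∈ F, ∀ v ∈ e, planar k v ∈ sqBox 0 M₀)
    {s : Set (F → ℝ)} (hs : MeasurableSet s) :
    (labelMeasure (slab 3 k)).real (evCircuit k p n N ∩ evBlocked k p N M ∩
        (fun (U : Sym2 (slab 3 k) → ℝ) (e : F) => U e) ⁻¹' s) =
      (labelMeasure (slab 3 k)).real (evCircuit k p n N ∩ evBlocked k p N M) *
        (labelMeasure (slab 3 k)).real ((fun (U : Sym2 (slab 3 k) → ℝ) (e : F) => U e) ⁻¹' s) := by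
  rw [evCircuit_inter_evBlocked_eq]
  exact labelMeasure_real_circuit_blocking_inter_eq_mul hM₀ hnN hNM p F hF hs

/-- **`𝓩 = 𝓑_o ∩ 𝓑_x ∩ C` is an event of the triple `(Γ_min(η_p), 𝓘_o^{Λ_M}, 𝓘_x^{Λ_M})`** (on `C` the minimal circuit
is non-empty, `minCircuit_ne_nil_iff`). [cite: NewmanTassionWu2017, §4 (𝓩^i = 𝓑_0^{m_i} ∩ 𝓑_x^{m_i} ∩ C_{n_i,2n_i}, p. 19)] -/
theorem glued_inter_eq_setOf (p : ℝ) (n N M : ℕ) (o x : slab 3 k) :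
    evGlued k p n N M o ∩ evGlued k p n N M x ∩ evCircuit k p n N =
      {U | (fun (Γ : List (slab 3 k)) (I J : Finset (slab 3 k)) =>
          (∀ g ∈ Γ, g ∈ I) ∧ (∀ g ∈ Γ, g ∈ J) ∧ Γ ≠ [])
        (minCircuit k (configOfLabels p U (slabGraph 3 k)) 0 n N)
        (invasion (slabGraph 3 k) U o (exitIndex (slabGraph 3 k) U o (ballFinset k 0 M)))
        (invasion (slabGraph 3 k) U x (exitIndex (slabGraph 3 k) U x (ballFinset k 0 M)))} := by
  ext U
  have hC : U ∈ evCircuit k p n N ↔ minCircuit k (configOfLabels p U (slabGraph 3 k)) 0 n N ≠ [] :=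
    minCircuit_ne_nil_iff.symm
  simp only [Set.mem_inter_iff, Set.mem_setOf_eq, hC]
  exact ⟨fun ⟨⟨h1, h2⟩, h3⟩ => ⟨h1, h2, h3⟩, fun ⟨h1, h2, h3⟩ => ⟨⟨h1, h2⟩, h3⟩⟩

/-- `𝓩` is measurable. [cite: NewmanTassionWu2017, §4 (p. 19)] -/
theorem measurableSet_glued_inter (p : ℝ) (n N M : ℕ) (o x : slab 3 k) :
    MeasurableSet (evGlued k p n N M o ∩ evGlued k p n N M x ∩ evCircuit k p n N) := by
  rw [glued_inter_eq_setOf]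
  exact measurableSet_setOf.2 (measurable_minCircuit_stoppedInvasions_prop p 0 n N o x (ballFinset k 0 M)
    (ballFinset k 0 M) fun (Γ : List (slab 3 k)) (I J : Finset (slab 3 k)) =>
      (∀ g ∈ Γ, g ∈ I) ∧ (∀ g ∈ Γ, g ∈ J) ∧ Γ ≠ [])

/-- **`𝓩 ∈ σ(U_e : e ∈ F)`** for every finite `F` containing the pairs over `B̄_{M+1}` (`N ≤ M + 1`): the hypothesis `hZ` of
`NTW17.ae_frequently_mem_labelMeasure`. [cite: NewmanTassionWu2017, §4 (p. 19: "𝓩^{i-1} is measurable with respect to the state of edges in B̄_{m_{i-1}}")] -/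
theorem exists_preimage_eq_glued_inter {n N M : ℕ} (hNM : N ≤ M + 1) (p : ℝ) (o x : slab 3 k)
    (F : Finset (Sym2 (slab 3 k))) (hF : ∀ e : Sym2 (slab 3 k), (∀ v ∈ e, planar k v ∈ sqBox 0 (M + 1)) → e ∈ F) :
    ∃ s : Set (F → ℝ), MeasurableSet s ∧
      (fun (U : Sym2 (slab 3 k) → ℝ) (e : F) => U e) ⁻¹' s =
        evGlued k p n N M o ∩ evGlued k p n N M x ∩ evCircuit k p n N := by
  rw [glued_inter_eq_setOf]
  have hball : ∀ v ∈ ballFinset k (0 : ℤ × ℤ) M, planar k v ∈ sqBox 0 M := fun v hv => (mem_ballFinset k).1 hv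
  exact exists_preimage_eq_minCircuit_stoppedInvasions (M := M + 1) (M' := M) (r := n) (sqBox_mono 0 hNM) le_rfl
    hball hball p o x (fun (Γ : List (slab 3 k)) (I J : Finset (slab 3 k)) =>
      (∀ g ∈ Γ, g ∈ I) ∧ (∀ g ∈ Γ, g ∈ J) ∧ Γ ≠ []) F hF

/-- The specialisation `F = ` the pairs over `B̄_{M+1}`. [cite: NewmanTassionWu2017, §4 (p. 19)] -/
theorem exists_preimage_eq_glued_inter_box {n N M : ℕ} (hNM : N ≤ M + 1) (p : ℝ) (o x : slab 3 k) :
    ∃ s : Set ((finite_sym2 (slabLift_finite k (sqBox_finite (0 : ℤ × ℤ) (M + 1)))).toFinset → ℝ), MeasurableSet s ∧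
      (fun (U : Sym2 (slab 3 k) → ℝ) (e : (finite_sym2 (slabLift_finite k (sqBox_finite (0 : ℤ × ℤ) (M + 1)))).toFinset) =>
          U e) ⁻¹' s =
        evGlued k p n N M o ∩ evGlued k p n N M x ∩ evCircuit k p n N :=
  exists_preimage_eq_glued_inter hNM p o x _ fun e he => (mem_toFinset_sym2_slabLift_iff 0 (M + 1) e).2 he

end Bridge

/-! ## The renewal step: `𝓩^i` occurs for some `i`, hence `𝓘_o ∩ 𝓘_x ≠ ∅` -/

section Renewal

/-- On `𝓩 = 𝓑_o ∩ 𝓑_x ∩ C` the invaded regions of `o` and `x` share a vertex (any vertex of `Γ_min ≠ ∅`).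
[cite: NewmanTassionWu2017, §4 (p. 19: "𝓩_x^i occurs …, which implies V(Γ_min^{(i)}) ⊆ 𝓘_0 ∩ 𝓘_x")] -/
theorem nonempty_invadedRegion_inter_of_mem_glued {p : ℝ} {n N M : ℕ} {o x : slab 3 k} {U : Sym2 (slab 3 k) → ℝ}
    (hU : U ∈ evGlued k p n N M o ∩ evGlued k p n N M x ∩ evCircuit k p n N) :
    (invadedRegion (slabGraph 3 k) U o ∩ invadedRegion (slabGraph 3 k) U x).Nonempty := by
  obtain ⟨⟨ho, hx⟩, hC⟩ := hU
  have hne : circuitOf k p n N U ≠ [] := minCircuit_ne_nil_iff.2 hC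
  obtain ⟨g, hg⟩ := List.exists_mem_of_ne_nil (circuitOf k p n N U) hne
  exact ⟨g, (mem_invadedRegion (slabGraph 3 k)).2 ⟨_, ho g hg⟩, (mem_invadedRegion (slabGraph 3 k)).2 ⟨_, hx g hg⟩⟩

/-- **Comparison with i.i.d. trials, assembled**: along scales `r`, `m` (`m` monotone, `1 ≤ m i`, `2 r i ≤ m i`), with
`𝓩^i = 𝓑_o ∩ 𝓑_x ∩ C` at `(n, N, M) = (r i, 2 r i, m i − 1)` and `F i` = the pairs over `B̄_{m_i}`: if for every `i > i₀`
and every `A = {U | (U e)_{e ∈ F (i-1)} ∈ t}`, `c · μ(A) ≤ μ(𝓩^i ∩ A)` with `c > 0`, then almost surely the invaded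
regions of `o` and `x` meet. [cite: NewmanTassionWu2017, §4 (proof of Theorem 2.4, p. 19)] -/
theorem ae_nonempty_invadedRegion_inter_of_glue (p : ℝ) (r m : ℕ → ℕ) (hm : Monotone m) (h1 : ∀ i, 1 ≤ m i)
    (hrm : ∀ i, 2 * r i ≤ m i) (o x : slab 3 k) {c : ℝ} (hc : 0 < c) (i₀ : ℕ)
    (hglue : ∀ i, i₀ < i →
      ∀ t : Set ((finite_sym2 (slabLift_finite k (sqBox_finite (0 : ℤ × ℤ) (m (i - 1))))).toFinset → ℝ),
        MeasurableSet t →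
        c * (labelMeasure (slab 3 k)).real
            ((fun (U : Sym2 (slab 3 k) → ℝ)
                (e : (finite_sym2 (slabLift_finite k (sqBox_finite (0 : ℤ × ℤ) (m (i - 1))))).toFinset) => U e) ⁻¹' t) ≤
          (labelMeasure (slab 3 k)).real
            ((evGlued k p (r i) (2 * r i) (m i - 1) o ∩ evGlued k p (r i) (2 * r i) (m i - 1) x ∩
                evCircuit k p (r i) (2 * r i)) ∩
              (fun (U : Sym2 (slab 3 k) → ℝ)
                (e : (finite_sym2 (slabLift_finite k (sqBox_finite (0 : ℤ × ℤ) (m (i - 1))))).toFinset) => U e) ⁻¹' t)) :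
    ∀ᵐ U ∂(labelMeasure (slab 3 k)),
      (invadedRegion (slabGraph 3 k) U o ∩ invadedRegion (slabGraph 3 k) U x).Nonempty := by
  have hF : Monotone fun i => (finite_sym2 (slabLift_finite k (sqBox_finite (0 : ℤ × ℤ) (m i)))).toFinset :=
    monotone_toFinset_sym2_slabLift 0 hm
  have hZ : ∀ i, ∃ s : Set ((finite_sym2 (slabLift_finite k (sqBox_finite (0 : ℤ × ℤ) (m i)))).toFinset → ℝ),
      MeasurableSet s ∧
      (fun (U : Sym2 (slab 3 k) → ℝ) (e : (finite_sym2 (slabLift_finite k (sqBox_finite (0 : ℤ × ℤ) (m i)))).toFinset) =>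
          U e) ⁻¹' s =
        evGlued k p (r i) (2 * r i) (m i - 1) o ∩ evGlued k p (r i) (2 * r i) (m i - 1) x ∩ evCircuit k p (r i) (2 * r i) := by
    intro i
    refine exists_preimage_eq_glued_inter (M := m i - 1) (by have := hrm i; have := h1 i; omega) p o x _ fun e he => ?_
    rw [Nat.sub_add_cancel (h1 i)] at he
    exact (mem_toFinset_sym2_slabLift_iff 0 (m i) e).2 he
  have h := NTW17.ae_frequently_mem_labelMeasure (V := slab 3 k)
    (fun i => (finite_sym2 (slabLift_finite k (sqBox_finite (0 : ℤ × ℤ) (m i)))).toFinset) hF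
    (fun i => evGlued k p (r i) (2 * r i) (m i - 1) o ∩ evGlued k p (r i) (2 * r i) (m i - 1) x ∩
      evCircuit k p (r i) (2 * r i)) hZ hc (i₀ := i₀) hglue
  filter_upwards [h] with U hU
  obtain ⟨j, hj⟩ := hU.exists
  exact nonempty_invadedRegion_inter_of_mem_glued hj

/-- The planar part of the origin of the slab is the origin of `ℤ²`. [folklore] -/
theorem planar_slabOrigin (k : ℕ) : planar k (slabOrigin 3 k) = 0 := rfl

/-- **NTW §4, assembled modulo Lemma 4.1.**  If the gluing lemma holds in the shape of the lane's
`real_glued_inter_preimage_ge` (for all levels `0 < p < b < 1`, scales `1 ≤ n ≤ N`, `N + 1 ≤ M`, roots over `B_{n-1}`, a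
uniform exponent `s`, and every event `A` read off the labels of a finite set of pairs over `B̄_{n-1}`:
`c · μ(A) ≤ μ(C ∩ D′ ∩ A)` implies `c / ((1+K)(1+2K)) · μ(A) ≤ μ(𝓑_a ∩ 𝓑_x ∩ C ∩ A)`, `K = (2/(p ∧ (1−b)))^s`), then for
`k ≥ 1` and every vertex `x` of `S_k`, almost surely the invaded regions of the origin and of `x` meet.
[cite: NewmanTassionWu2017, §4 (proof of Theorem 2.4, p. 19: choice of the scales, Lemma 4.1, comparison with i.i.d. trials)] -/
theorem invasionMeet_of_lemma41 (hk : 1 ≤ k)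
    (hL41 : ∀ {p b : ℝ} {n N M : ℕ} {a x : slab 3 k} {s : ℕ}, 0 < p → p < b → b < 1 → 1 ≤ n → n ≤ N → N + 1 ≤ M →
      planar k a ∈ sqBox ((0 : ℤ), (0 : ℤ)) (n - 1) → planar k x ∈ sqBox ((0 : ℤ), (0 : ℤ)) (n - 1) →
      (∀ (Γ : List (slab 3 k)) (y : ℤ × ℤ), (surgFin k Γ y).card ≤ s) →
      ∀ (F : Finset (Sym2 (slab 3 k))), (∀ e ∈ F, ∀ v ∈ e, planar k v ∈ sqBox ((0 : ℤ), (0 : ℤ)) (n - 1)) →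
      ∀ {t : Set (F → ℝ)}, MeasurableSet t → ∀ {c : ℝ},
      c * (labelMeasure (slab 3 k)).real ((fun (U : Sym2 (slab 3 k) → ℝ) (e : F) => U e) ⁻¹' t) ≤
        (labelMeasure (slab 3 k)).real (evCircuit k p n N ∩ evBlocked k p N M ∩
          (fun (U : Sym2 (slab 3 k) → ℝ) (e : F) => U e) ⁻¹' t) →
      c / ((1 + (2 / min p (1 - b)) ^ s) * (1 + 2 * (2 / min p (1 - b)) ^ s)) *
          (labelMeasure (slab 3 k)).real ((fun (U : Sym2 (slab 3 k) → ℝ) (e : F) => U e) ⁻¹' t) ≤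
        (labelMeasure (slab 3 k)).real ((evGlued k p n N M a ∩ evGlued k p n N M x ∩ evCircuit k p n N) ∩
          (fun (U : Sym2 (slab 3 k) → ℝ) (e : F) => U e) ⁻¹' t))
    (x : slab 3 k) :
    ∀ᵐ U ∂(labelMeasure (slab 3 k)),
      (invadedRegion (slabGraph 3 k) U (slabOrigin 3 k) ∩ invadedRegion (slabGraph 3 k) U x).Nonempty := by
  -- the level, the auxiliary level `b`, the uniform exponent `s`
  set p : ℝ := ((criticalProbIOf (slabGraph 3 k) (slabOrigin 3 k) : unitInterval) : ℝ) with hp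
  obtain ⟨hp0, hp1⟩ := criticalProb_slab_pos_lt_one k
  set b : ℝ := (1 + p) / 2 with hb
  have hpb : p < b := by rw [hb]; linarith
  have hb1 : b < 1 := by rw [hb]; linarith
  set K : ℝ := (2 / min p (1 - b)) ^ ((9 * (k + 1)) ^ 2) with hK
  have hK0 : 0 ≤ K := by
    have : 0 ≤ 2 / min p (1 - b) := div_nonneg zero_le_two (le_min hp0.le (by linarith))
    exact pow_nonneg this _
  have hs : ∀ (Γ : List (slab 3 k)) (y : ℤ × ℤ), (surgFin k Γ y).card ≤ (9 * (k + 1)) ^ 2 :=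
    fun Γ y => card_toFinset_surgS_le Γ y _
  -- the scales, with the independence clause
  obtain ⟨lam, hlam, c₀, hc₀, r, m, hr, hm, -, h52, hg1, hsep, hg2, -, hind⟩ :=
    exists_scaleSequences_indep (k := k) hk (fun t => t + 2) (fun t => by omega)
  -- the index beyond which `x` lies over `B_{r_i - 1}`
  set i₀ : ℕ := (|(planar k x).1| + |(planar k x).2|).toNat + 1 with hi₀
  have hxbox : ∀ i, i₀ < i → planar k x ∈ sqBox ((0 : ℤ), (0 : ℤ)) (r i - 1) := by
    intro i hi
    have hri : i ≤ r i := hr.id_le i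
    have h0 := Int.self_le_toNat (|(planar k x).1| + |(planar k x).2|)
    have h1 := abs_nonneg (planar k x).1
    have h2 := abs_nonneg (planar k x).2
    have hcast : ((i₀ : ℕ) : ℤ) ≤ ((r i - 1 : ℕ) : ℤ) := by exact_mod_cast (by omega : i₀ ≤ r i - 1)
    simp only [sqBox, Set.mem_setOf_eq, sub_zero]
    push_cast [hi₀] at hcast
    constructor <;> linarith
  -- the conditional bound of the renewal step
  set c : ℝ := c₀ / 2 / ((1 + K) * (1 + 2 * K)) with hc
  have hcpos : 0 < c := by rw [hc]; positivity
  refine ae_nonempty_invadedRegion_inter_of_glue p r m hm.monotone (fun i => by have := hsep i; omega)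
    (fun i => by have := hsep i; omega) (slabOrigin 3 k) x hcpos i₀ fun i hi t ht => ?_
  -- hypotheses of Lemma 4.1 at scale `i`
  have hn : 1 ≤ r i := by have := h52 i; omega
  have hnN : r i ≤ 2 * r i := by omega
  have hNM : 2 * r i + 1 ≤ m i - 1 := by have := hsep i; omega
  have ha : planar k (slabOrigin 3 k) ∈ sqBox ((0 : ℤ), (0 : ℤ)) (r i - 1) := by
    rw [planar_slabOrigin]; exact ⟨by simp, by simp⟩
  have hmr : m (i - 1) ≤ r i - 1 := by
    have hi1 : i - 1 + 1 = i := by omega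
    have := hg2 (i - 1)
    rw [hi1] at this
    omega
  have hF : ∀ e ∈ (finite_sym2 (slabLift_finite k (sqBox_finite (0 : ℤ × ℤ) (m (i - 1))))).toFinset,
      ∀ v ∈ e, planar k v ∈ sqBox ((0 : ℤ), (0 : ℤ)) (r i - 1) := fun e he v hv =>
    sqBox_mono 0 hmr ((mem_toFinset_sym2_slabLift_iff 0 (m (i - 1)) e).1 he v hv)
  have hF₀ : ∀ e ∈ (finite_sym2 (slabLift_finite k (sqBox_finite (0 : ℤ × ℤ) (m (i - 1))))).toFinset,
      ∀ v ∈ e, planar k v ∈ sqBox (0 : ℤ × ℤ) (m (i - 1)) := fun e he =>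
    (mem_toFinset_sym2_slabLift_iff 0 (m (i - 1)) e).1 he
  -- independence: `(c₀/2) μ(A) ≤ μ(C ∩ D′ ∩ A)`
  have hindep : c₀ / 2 * (labelMeasure (slab 3 k)).real
      ((fun (U : Sym2 (slab 3 k) → ℝ)
        (e : (finite_sym2 (slabLift_finite k (sqBox_finite (0 : ℤ × ℤ) (m (i - 1))))).toFinset) => U e) ⁻¹' t) ≤
      (labelMeasure (slab 3 k)).real (evCircuit k p (r i) (2 * r i) ∩ evBlocked k p (2 * r i) (m i - 1) ∩
        (fun (U : Sym2 (slab 3 k) → ℝ)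
          (e : (finite_sym2 (slabLift_finite k (sqBox_finite (0 : ℤ × ℤ) (m (i - 1))))).toFinset) => U e) ⁻¹' t) := by
    have hmi : m i - 1 + 1 = m i := Nat.sub_add_cancel (by have := hsep i; omega)
    rw [evCircuit_inter_evBlocked_eq, hmi]
    exact hind i (m (i - 1)) (by omega) _ hF₀ t ht
  have := hL41 hp0 hpb hb1 hn hnN hNM ha (hxbox i hi) hs _ hF ht hindep
  simpa only [hc, hK] using this

end Renewal

/-! ## Proposition 2.3 on the slab: `invasionMeet → thm24` -/

section Reduction

/-- **NTW's reduction to the meeting of invasion clusters (Prop. 2.3 / LPS06 Prop. 3.3), slab form**: if for every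
`k ≥ 1` and every vertex `x` the invaded regions of the origin and of `x` meet a.s., then for every `k ≥ 1` the wired
minimal spanning forest of `S_k` is a.s. a single tree (labels are a.s. injective: `ae_injective_labelMeasure`).
[cite: NewmanTassionWu2017, §2.4 (Prop. 2.3: "it suffices to prove that for any x ∈ S_k, 𝓘_0 ∩ 𝓘_x ≠ ∅"); LyonsPeresSchramm2006, Prop. 3.3] -/
theorem NewmanTassionWu2017.thm24_of_invasionMeet (h : NewmanTassionWu2017_invasionMeet) :
    NewmanTassionWu2017_thm24 := by
  intro k hk
  have hinj := Literature.Barriers.CriticalPhenomena.ae_injective_labelMeasure (V := slab 3 k)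
  have hmeet : ∀ᵐ U ∂(labelMeasure (slab 3 k)), ∀ x : slab 3 k,
      (invadedRegion (slabGraph 3 k) U (slabOrigin 3 k) ∩ invadedRegion (slabGraph 3 k) U x).Nonempty :=
    ae_all_iff.2 fun x => h k hk x
  filter_upwards [hinj, hmeet] with U hU hM x y
  obtain ⟨v, hvo, hvx⟩ := hM x
  obtain ⟨w, hwo, hwy⟩ := hM y
  exact (Rsw3.wmsf_reachable_of_common_vertex hU.injOn hvx hvo).trans
    (Rsw3.wmsf_reachable_of_common_vertex hU.injOn hwo hwy)

/-- Hence Theorem 2.4 from Lemma 4.1 (in the shape of `invasionMeet_of_lemma41`), for the record of the dependency.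
[cite: NewmanTassionWu2017, Theorem 2.4 (proof, §4)] -/
theorem thm24_of_lemma41
    (hL41 : ∀ (k : ℕ), 1 ≤ k → ∀ {p b : ℝ} {n N M : ℕ} {a x : slab 3 k} {s : ℕ}, 0 < p → p < b → b < 1 → 1 ≤ n →
      n ≤ N → N + 1 ≤ M →
      planar k a ∈ sqBox ((0 : ℤ), (0 : ℤ)) (n - 1) → planar k x ∈ sqBox ((0 : ℤ), (0 : ℤ)) (n - 1) →
      (∀ (Γ : List (slab 3 k)) (y : ℤ × ℤ), (surgFin k Γ y).card ≤ s) →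
      ∀ (F : Finset (Sym2 (slab 3 k))), (∀ e ∈ F, ∀ v ∈ e, planar k v ∈ sqBox ((0 : ℤ), (0 : ℤ)) (n - 1)) →
      ∀ {t : Set (F → ℝ)}, MeasurableSet t → ∀ {c : ℝ},
      c * (labelMeasure (slab 3 k)).real ((fun (U : Sym2 (slab 3 k) → ℝ) (e : F) => U e) ⁻¹' t) ≤
        (labelMeasure (slab 3 k)).real (evCircuit k p n N ∩ evBlocked k p N M ∩
          (fun (U : Sym2 (slab 3 k) → ℝ) (e : F) => U e) ⁻¹' t) →
      c / ((1 + (2 / min p (1 - b)) ^ s) * (1 + 2 * (2 / min p (1 - b)) ^ s)) *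
          (labelMeasure (slab 3 k)).real ((fun (U : Sym2 (slab 3 k) → ℝ) (e : F) => U e) ⁻¹' t) ≤
        (labelMeasure (slab 3 k)).real ((evGlued k p n N M a ∩ evGlued k p n N M x ∩ evCircuit k p n N) ∩
          (fun (U : Sym2 (slab 3 k) → ℝ) (e : F) => U e) ⁻¹' t)) :
    NewmanTassionWu2017_thm24 :=
  NewmanTassionWu2017.thm24_of_invasionMeet fun k hk x => invasionMeet_of_lemma41 hk (hL41 k hk) x

end Reduction

end Summit.CriticalPhenomena.PercolationContinuityZ3.Theorems.Crossing
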